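import Summits.BirchSwinnertonDyer.BirchSwinnertonDyer.Theorems.AlignedTransportAtTwoMainConjectureOfRankZeroBSDAtTwoSexticNormRelationDescent
import HarnessLib

/-!
# Route `AlignedTransportAtTwo`, crux C2 `MainConjectureOfRankZeroBSDAtTwo` (stmt-BirchSwinnertonDyer-22298):
# THE `S₃` NORM-RELATION DESCENT AT `p = 2`, part 2 — `e_n(ℚ(W[2])) = 0 ∀ n` and `μ₂(ℚ(W[2])^{cyc}) = 0` from the cubic and resolvent towers

Sequel of `…SexticNormRelationDescent` (same seat bsd-line-att-p4 g28, §1–§3 there: the Galois group of `T = ℚ(W[2])` of order `6` with the fixing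
subgroups of the three cubic subfields and of the resolvent, this seat's `S₃` norm relation `NormRelation.normRelation_card_six` instantiated on it, and
`T ∩ ℚ_∞ = ℚ`).  HONEST FRAMING: WIDTH-5 attached prover seat on line `birth` of the lead `bsd-line-att-p2`; `--supports` stmt-BirchSwinnertonDyer-22298,
closes nothing; BSD is NOT proved; crux C2, its verdict «blocked-on `Rank1Residual.GreenbergMuConjectureIrreducible`» and every registered stub untouched.
THEOREMS ONLY.

§4 here: the fixed fields as MODELS in `ℚ̄` (`T^{H_j} ≅ ℚ(β_j)`, `T^C ≅ ℚ(δ)`, `T^G ≅ ℚ`, Galois correspondence + `IntermediateField.equivMap`), the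
surjectivity of the cyclotomic character on each, and the two corollaries of cell `bsd-potss`'s per-layer inequality
`IwasawaTheory.classNumberPExp_restrict_le_sum_of_normRelation` ([BiasseEtAl2022] Prop. 3.7, denominator `3`, `2 ∤ 3`):
★ `classNumberPExp_divisionField_two_eq_zero_of_cubic_of_resolvent` — `e_n = 0` at every layer of the cyclotomic `ℤ₂`-towers of the three cubic fields and
of the resolvent ⟹ `e_n(T) = 0` at every layer (`e_n(ℚ) = 0`, Iwasawa 1956, tree) — and ★ `classicalMuVanishes_divisionField_two_of_cubic_of_resolvent` —
`μ₂ = 0` (growth form) for those towers ⟹ `μ₂ = 0` for every cyclotomic `ℤ₂`-extension of `T`. KERNEL: no Iwasawa 1973, no Ferrero–Washington. The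
`S₃`-sextic is Lim's natural carrier (`E[2] ⊆ E(T)`); the line's PFμ⁺ docstring reached it from the cubic «modulo CFT print [Iw73]» — removed here for `T`
(the step to `ℚ(W[2], i)` remains print). CONDITIONAL only on the displayed tower inputs; nothing closed.

References: [BiasseEtAl2022] Prop. 3.7; [Washington1997] §13.1, Prop. 13.22; [NeukirchANT1999] III (1.6); [MilneFT2022] Ch. 3; tree: part 1 (this seat),
`Literature/…/NormRelationSymmetricThree` (this seat), `ClassicalMuVanishesNormRelationTower` / `…IffBoundedRank` / `…KleinDescent` / `…CyclicAscentOddRat` /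
`…QuadraticAscentSqrtOdd` / `…ImaginaryQuadraticTwoProofs` (cell bsd-potss), `…SexticTowerGrowth` (att-p3 g26).
-/

set_option linter.dupNamespace false
set_option autoImplicit false

noncomputable section

open scoped Classical NumberField

namespace Summit.BirchSwinnertonDyer.BirchSwinnertonDyer.Theorems.AlignedTransportAtTwoSexticNormRelationDescentMu

open NumberField Polynomial WeierstrassCurve IntermediateField Field
  Literature.NumberTheory.EllipticCurves Literature.NumberTheory.EllipticCurves.Greenberg1999
  Literature.NumberTheory.EllipticCurves.DokchitserDokchitser2012
  Literature.NumberTheory.EllipticCurves.ZpExtension Literature.NumberTheory.GaloisRepresentations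
  Literature.NumberTheory.IwasawaTheory Literature.NumberTheory.NumberFields
  Summit.BirchSwinnertonDyer.BirchSwinnertonDyer.Theorems.AlignedTransportAtTwoFineRoad.DivisionCubic
  Summit.BirchSwinnertonDyer.BirchSwinnertonDyer.Theorems.AlignedTransportAtTwoFineRoad.TowerImageDelta
  Summit.BirchSwinnertonDyer.BirchSwinnertonDyer.Theorems.AlignedTransportAtTwoCubicClosureParity
  Summit.BirchSwinnertonDyer.BirchSwinnertonDyer.Theorems.AlignedTransportAtTwoSexticTowerGrowth
  Summit.BirchSwinnertonDyer.BirchSwinnertonDyer.Theorems.AlignedTransportAtTwoSexticNormRelationDescent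

variable (W : WeierstrassCurve ℚ) [W.IsElliptic]

/-! ## §4 The five fixed fields as models in `ℚ̄`, the descent inequality, and its corollaries -/

/-- `T^{H_j} ≅ ℚ(β_j) ⊆ ℚ̄` over `ℚ`. [cite: MilneFT2022, Ch. 3 (fundamental theorem)] -/
theorem nonempty_algEquiv_fixedField_cubic (j : Fin 3) :
    haveI : IsGalois ℚ (W.divisionField 2) := W.isGalois_divisionField 2
    Nonempty (↥(fixedField (ℚ⟮(⟨xT W two_ne_zero j, xT_mem W j⟩ : W.divisionField 2)⟯).fixingSubgroup) ≃ₐ[ℚ]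
      ↥ℚ⟮xT W two_ne_zero j⟯) := by
  haveI : IsGalois ℚ (W.divisionField 2) := W.isGalois_divisionField 2
  set E := ℚ⟮(⟨xT W two_ne_zero j, xT_mem W j⟩ : W.divisionField 2)⟯
  have h1 : fixedField E.fixingSubgroup = E := IsGalois.fixedField_fixingSubgroup E
  set ι : W.divisionField 2 →ₐ[ℚ] AlgebraicClosure ℚ := (algebraMap (W.divisionField 2) (AlgebraicClosure ℚ)).toRatAlgHom
  have h2 : E.map ι = ℚ⟮xT W two_ne_zero j⟯ := by
    change (IntermediateField.adjoin ℚ _).map ι = _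
    rw [IntermediateField.adjoin_map, Set.image_singleton]
    rfl
  exact ⟨(IntermediateField.equivOfEq h1).trans ((E.equivMap ι).trans (IntermediateField.equivOfEq h2))⟩

/-- `T^{C} ≅ ℚ(δ) ⊆ ℚ̄` over `ℚ`. [cite: MilneFT2022, Ch. 3 (fundamental theorem)] -/
theorem nonempty_algEquiv_fixedField_resolvent :
    haveI : IsGalois ℚ (W.divisionField 2) := W.isGalois_divisionField 2
    Nonempty (↥(fixedField (ℚ⟮(⟨4 * delta W two_ne_zero, (delta_mem_and_sq W).1⟩ : W.divisionField 2)⟯).fixingSubgroup) ≃ₐ[ℚ]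
      ↥ℚ⟮4 * delta W two_ne_zero⟯) := by
  haveI : IsGalois ℚ (W.divisionField 2) := W.isGalois_divisionField 2
  set D := ℚ⟮(⟨4 * delta W two_ne_zero, (delta_mem_and_sq W).1⟩ : W.divisionField 2)⟯
  have h1 : fixedField D.fixingSubgroup = D := IsGalois.fixedField_fixingSubgroup D
  set ι : W.divisionField 2 →ₐ[ℚ] AlgebraicClosure ℚ := (algebraMap (W.divisionField 2) (AlgebraicClosure ℚ)).toRatAlgHom
  have h2 : D.map ι = ℚ⟮4 * delta W two_ne_zero⟯ := by
    change (IntermediateField.adjoin ℚ _).map ι = _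
    rw [IntermediateField.adjoin_map, Set.image_singleton]
    rfl
  exact ⟨(IntermediateField.equivOfEq h1).trans ((D.equivMap ι).trans (IntermediateField.equivOfEq h2))⟩

/-- `T^{G} ≅ ℚ`. [cite: MilneFT2022, Ch. 3 (fundamental theorem)] -/
theorem nonempty_algEquiv_fixedField_top :
    haveI : IsGalois ℚ (W.divisionField 2) := W.isGalois_divisionField 2
    Nonempty (↥(fixedField (⊤ : Subgroup (W.divisionField 2 ≃ₐ[ℚ] W.divisionField 2))) ≃ₐ[ℚ] ℚ) := by
  haveI : IsGalois ℚ (W.divisionField 2) := W.isGalois_divisionField 2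
  exact ⟨(IntermediateField.equivOfEq (IsGalois.fixedField_top (F := ℚ) (E := W.divisionField 2))).trans
    (IntermediateField.botEquiv ℚ (W.divisionField 2))⟩

/-- `ℚ(β_j) ∩ ℚ_∞ = ℚ` (`2 ∤ 3 = [ℚ(β_j) : ℚ]`). [cite: Washington1997, §13.1] -/
theorem surjective_cubic_restrict (ht : ∀ x : ℚ, ¬ HasRationalTwoTorsionX W x) (κ : ZpExtension ℚ 2) (j : Fin 3) :
    haveI : FiniteDimensional ℚ ↥ℚ⟮xT W two_ne_zero j⟯ :=
      IntermediateField.adjoin.finiteDimensional ((AlgebraicClosure.isAlgebraic ℚ).isAlgebraic _).isIntegral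
    haveI : NumberField ↥ℚ⟮xT W two_ne_zero j⟯ := NumberField.mk
    Function.Surjective (κ.toContinuousMonoidHom.comp (absGaloisRestrict ℚ ↥ℚ⟮xT W two_ne_zero j⟯)) := by
  haveI : FiniteDimensional ℚ ↥ℚ⟮xT W two_ne_zero j⟯ :=
    IntermediateField.adjoin.finiteDimensional ((AlgebraicClosure.isAlgebraic ℚ).isAlgebraic _).isIntegral
  haveI : NumberField ↥ℚ⟮xT W two_ne_zero j⟯ := NumberField.mk
  have hirr := AlignedTransportAtTwoSeed.irr_two_of_forall_not_hasRationalTwoTorsionX W ht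
  have hβ : aeval (xT W two_ne_zero j) W.twoTorsionPolynomial.toPoly = 0 :=
    (mem_rootSet_of_ne (twoTorsionPolynomial_toPoly_ne_zero W two_ne_zero)).mp (xT_mem_rootSet W two_ne_zero j)
  have h3 := AddKatoTwo.finrank_adjoin_root_twoTorsionPolynomial_eq_three W hirr hβ
  refine surjective_comp_absGaloisRestrict_of_not_dvd_finrank κ _ ?_
  have h3' : Module.finrank ℚ ↥ℚ⟮xT W two_ne_zero j⟯ = 3 := h3
  rw [h3']; decide

/-- `ℚ(δ) ∩ ℚ_∞ = ℚ` (`ℚ(δ)` imaginary quadratic, `√2 ∉ ℚ(δ)`). [cite: Washington1997, §13.1] -/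
theorem surjective_resolvent_restrict (hΔ : W.Δ < 0) (κ : ZpExtension ℚ 2) (hκ : κ.IsCyclotomic) :
    haveI : FiniteDimensional ℚ ↥ℚ⟮4 * delta W two_ne_zero⟯ :=
      IntermediateField.adjoin.finiteDimensional ((AlgebraicClosure.isAlgebraic ℚ).isAlgebraic _).isIntegral
    haveI : NumberField ↥ℚ⟮4 * delta W two_ne_zero⟯ := NumberField.mk
    Function.Surjective (κ.toContinuousMonoidHom.comp (absGaloisRestrict ℚ ↥ℚ⟮4 * delta W two_ne_zero⟯)) := by
  haveI : FiniteDimensional ℚ ↥ℚ⟮4 * delta W two_ne_zero⟯ :=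
    IntermediateField.adjoin.finiteDimensional ((AlgebraicClosure.isAlgebraic ℚ).isAlgebraic _).isIntegral
  haveI : NumberField ↥ℚ⟮4 * delta W two_ne_zero⟯ := NumberField.mk
  have hsq : ¬ IsSquare W.Δ := fun ⟨r, hr⟩ ↦ by nlinarith [mul_self_nonneg r]
  have hδ := (delta_mem_and_sq W).2
  have h2 : Module.finrank ℚ ↥ℚ⟮4 * delta W two_ne_zero⟯ = 2 := finrank_adjoin_eq_two_of_sq_eq hδ hsq
  have hd : ((⟨4 * delta W two_ne_zero, mem_adjoin_simple_self ℚ _⟩ : ↥ℚ⟮4 * delta W two_ne_zero⟯) : ↥ℚ⟮4 * delta W two_ne_zero⟯) ^ 2 =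
      ((W.Δ : ℚ) : ↥ℚ⟮4 * delta W two_ne_zero⟯) := by
    apply Subtype.ext
    push_cast
    exact hδ
  have htc : IsTotallyComplex ↥ℚ⟮4 * delta W two_ne_zero⟯ := isTotallyComplex_of_sq_eq_ratCast hd hΔ
  exact surjective_comp_absGaloisRestrict_imaginaryQuadratic_two hκ _ ⟨h2, htc⟩

/-- ★ **THE DESCENT, CLASS-NUMBER FORM.** `W/ℚ` elliptic, no rational `2`-torsion abscissa, `Δ_W < 0`. If the cyclotomic `ℤ₂`-towers of the three
cubic fields `ℚ(β_j) ⊆ ℚ̄` and of the resolvent `ℚ(δ) ⊆ ℚ̄` (`δ = 4δ₀`, `δ² = Δ_W`) have `2 ∤ h` at EVERY layer, then so does the cyclotomic `ℤ₂`-tower of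
`T = ℚ(W[2])`: `e_n(T) = 0` for all `n` (hence `λ₂ = μ₂ = ν₂ = 0` for the `S₃`-sextic). Per layer: `e_n(T) ≤ Σ_j e_n(ℚ(β_j)) + e_n(ℚ(δ)) + e_n(ℚ)`
([BiasseEtAl2022] Prop. 3.7 with the `S₃` relation, `2 ∤ 3`; `e_n(ℚ) = 0` by Iwasawa 1956). KERNEL: no Iwasawa 1973, no Ferrero–Washington.
[cite: BiasseEtAl2022, Prop. 3.7] [cite: Washington1997, §13.1 and Prop. 13.22] [cite: NeukirchANT1999, Ch. III §1 Prop. (1.6) (iv)] -/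
theorem classNumberPExp_divisionField_two_eq_zero_of_cubic_of_resolvent (ht : ∀ x : ℚ, ¬ HasRationalTwoTorsionX W x) (hΔ : W.Δ < 0)
    (hK : ∀ j : Fin 3, ∀ κj : ZpExtension ↥ℚ⟮xT W two_ne_zero j⟯ 2, κj.IsCyclotomic → ∀ n, classNumberPExp κj n = 0)
    (hk : ∀ κk : ZpExtension ↥ℚ⟮4 * delta W two_ne_zero⟯ 2, κk.IsCyclotomic → ∀ n, classNumberPExp κk n = 0)
    (κT : ZpExtension (W.divisionField 2) 2) (hκT : κT.IsCyclotomic) (n : ℕ) :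
    classNumberPExp κT n = 0 := by
  haveI : NumberField (W.divisionField 2) := NumberField.mk
  haveI : IsGalois ℚ (W.divisionField 2) := W.isGalois_divisionField 2
  haveI : ∀ j : Fin 3, FiniteDimensional ℚ ↥ℚ⟮xT W two_ne_zero j⟯ := fun j ↦
    IntermediateField.adjoin.finiteDimensional ((AlgebraicClosure.isAlgebraic ℚ).isAlgebraic _).isIntegral
  haveI : ∀ j : Fin 3, NumberField ↥ℚ⟮xT W two_ne_zero j⟯ := fun j ↦ NumberField.mk
  haveI : FiniteDimensional ℚ ↥ℚ⟮4 * delta W two_ne_zero⟯ :=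
    IntermediateField.adjoin.finiteDimensional ((AlgebraicClosure.isAlgebraic ℚ).isAlgebraic _).isIntegral
  haveI : NumberField ↥ℚ⟮4 * delta W two_ne_zero⟯ := NumberField.mk
  obtain ⟨κ, hκ⟩ := exists_cyclotomicZpExtension_holds ℚ 2
  have hL := surjective_gal_restrict W ht hΔ κ hκ
  set FAM : Fin 5 → Subgroup (W.divisionField 2 ≃ₐ[ℚ] W.divisionField 2) :=
    ![(ℚ⟮(⟨xT W two_ne_zero 0, xT_mem W 0⟩ : W.divisionField 2)⟯).fixingSubgroup,
      (ℚ⟮(⟨xT W two_ne_zero 1, xT_mem W 1⟩ : W.divisionField 2)⟯).fixingSubgroup,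
      (ℚ⟮(⟨xT W two_ne_zero 2, xT_mem W 2⟩ : W.divisionField 2)⟯).fixingSubgroup,
      (ℚ⟮(⟨4 * delta W two_ne_zero, (delta_mem_and_sq W).1⟩ : W.divisionField 2)⟯).fixingSubgroup, ⊤] with hFAM
  have hH : ∀ i, Function.Surjective (κ.toContinuousMonoidHom.comp (absGaloisRestrict ℚ ↥(fixedField (FAM i)))) :=
    fun i ↦ surjective_comp_absGaloisRestrict_of_tower κ ↥(fixedField (FAM i)) (W.divisionField 2) hL
  have hineq := classNumberPExp_restrict_le_sum_of_normRelation κ (W.divisionField 2) hL FAM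
    (![fun x => if x = 1 then (1 : ℤ) else 0, fun x => if x = 1 then (1 : ℤ) else 0,
        fun x => if x = 1 then (1 : ℤ) else 0, fun x => if x = 1 then (1 : ℤ) else 0,
        fun x => if x = 1 then (-1 : ℤ) else 0])
    (fun (_ : Fin 5) (y : W.divisionField 2 ≃ₐ[ℚ] W.divisionField 2) => if y = 1 then (1 : ℤ) else 0) (d := 3) (by decide)
    (normRelation_gal W ht hΔ) hH n
  -- the five terms vanish
  have tK : ∀ j : Fin 3, ∀ (hs : Function.Surjective (κ.toContinuousMonoidHom.comp
      (absGaloisRestrict ℚ ↥(fixedField (ℚ⟮(⟨xT W two_ne_zero j, xT_mem W j⟩ : W.divisionField 2)⟯).fixingSubgroup)))),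
      classNumberPExp (κ.restrict _ hs) n = 0 := by
    intro j hs
    obtain ⟨φ⟩ := nonempty_algEquiv_fixedField_cubic W j
    have h' := surjective_cubic_restrict W ht κ j
    rw [classNumberPExp_restrict_eq_of_algEquiv κ φ hs h' n]
    exact hK j _ (isCyclotomic_restrict κ hκ _ h') n
  have tC : ∀ (hs : Function.Surjective (κ.toContinuousMonoidHom.comp
      (absGaloisRestrict ℚ ↥(fixedField (ℚ⟮(⟨4 * delta W two_ne_zero, (delta_mem_and_sq W).1⟩ : W.divisionField 2)⟯).fixingSubgroup)))),
      classNumberPExp (κ.restrict _ hs) n = 0 := by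
    intro hs
    obtain ⟨φ⟩ := nonempty_algEquiv_fixedField_resolvent W
    have h' := surjective_resolvent_restrict W hΔ κ hκ
    rw [classNumberPExp_restrict_eq_of_algEquiv κ φ hs h' n]
    exact hk _ (isCyclotomic_restrict κ hκ _ h') n
  have tQ : ∀ (hs : Function.Surjective (κ.toContinuousMonoidHom.comp
      (absGaloisRestrict ℚ ↥(fixedField (⊤ : Subgroup (W.divisionField 2 ≃ₐ[ℚ] W.divisionField 2)))))),
      classNumberPExp (κ.restrict _ hs) n = 0 := by
    intro hs
    obtain ⟨φ⟩ := nonempty_algEquiv_fixedField_top W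
    have h' : Function.Surjective (κ.toContinuousMonoidHom.comp (absGaloisRestrict ℚ ℚ)) :=
      surjective_comp_absGaloisRestrict_of_not_dvd_finrank κ ℚ (by rw [Module.finrank_self]; decide)
    rw [classNumberPExp_restrict_eq_of_algEquiv κ φ hs h' n]
    exact classNumberPExp_rat_eq_zero _ n
  have hsum : ∑ i : Fin 5, classNumberPExp (κ.restrict ↥(fixedField (FAM i)) (hH i)) n = 0 := by
    apply Finset.sum_eq_zero
    intro i _
    fin_cases i
    · exact tK 0 (hH 0)
    · exact tK 1 (hH 1)
    · exact tK 2 (hH 2)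
    · exact tC (hH 3)
    · exact tQ (hH 4)
  have hT : classNumberPExp (κ.restrict (W.divisionField 2) hL) n = 0 := Nat.le_zero.mp (hineq.trans (le_of_eq hsum))
  rw [classNumberPExp_eq_of_isCyclotomic κT (κ.restrict (W.divisionField 2) hL) hκT (isCyclotomic_restrict κ hκ _ hL) n]
  exact hT

/-- ★ **THE DESCENT, `μ`-FORM.** `W/ℚ` elliptic, no rational `2`-torsion abscissa, `Δ_W < 0`: Iwasawa's `μ₂ = 0` (growth form `ClassicalMuVanishes`)
for the cyclotomic `ℤ₂`-extensions of the cubic fields `ℚ(β_j)` and of the resolvent `ℚ(δ)` IMPLIES `μ₂ = 0` for every cyclotomic `ℤ₂`-extension of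
the `S₃`-sextic `T = ℚ(W[2])` — the carrier of Lim's theorem (`E[2] ⊆ E(T)`) and of the registered stub PFμ⁺'s middle step, reached from the cubic road
WITHOUT the CFT print [Iwasawa 1973] (`e_n(T) ≤ Σ_j e_n(ℚ(β_j)) + e_n(ℚ(δ)) + 0` per layer, so linear growth of the inputs gives linear growth of `e_n(T)`;
cell bsd-potss's fact-free `classicalMuVanishes_restrict_of_normRelation'`). [cite: BiasseEtAl2022, Prop. 3.7] [cite: Washington1997, §13.1]
[cite: RaySujatha2021, §1 eq. (1.1)] -/
theorem classicalMuVanishes_divisionField_two_of_cubic_of_resolvent (ht : ∀ x : ℚ, ¬ HasRationalTwoTorsionX W x) (hΔ : W.Δ < 0)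
    (hK : ∀ j : Fin 3, ∀ κj : ZpExtension ↥ℚ⟮xT W two_ne_zero j⟯ 2, κj.IsCyclotomic → ClassicalMuVanishes κj)
    (hk : ∀ κk : ZpExtension ↥ℚ⟮4 * delta W two_ne_zero⟯ 2, κk.IsCyclotomic → ClassicalMuVanishes κk)
    (κT : ZpExtension (W.divisionField 2) 2) (hκT : κT.IsCyclotomic) : ClassicalMuVanishes κT := by
  haveI : NumberField (W.divisionField 2) := NumberField.mk
  haveI : IsGalois ℚ (W.divisionField 2) := W.isGalois_divisionField 2
  haveI : ∀ j : Fin 3, FiniteDimensional ℚ ↥ℚ⟮xT W two_ne_zero j⟯ := fun j ↦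
    IntermediateField.adjoin.finiteDimensional ((AlgebraicClosure.isAlgebraic ℚ).isAlgebraic _).isIntegral
  haveI : ∀ j : Fin 3, NumberField ↥ℚ⟮xT W two_ne_zero j⟯ := fun j ↦ NumberField.mk
  haveI : FiniteDimensional ℚ ↥ℚ⟮4 * delta W two_ne_zero⟯ :=
    IntermediateField.adjoin.finiteDimensional ((AlgebraicClosure.isAlgebraic ℚ).isAlgebraic _).isIntegral
  haveI : NumberField ↥ℚ⟮4 * delta W two_ne_zero⟯ := NumberField.mk
  obtain ⟨κ, hκ⟩ := exists_cyclotomicZpExtension_holds ℚ 2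
  have hL := surjective_gal_restrict W ht hΔ κ hκ
  set FAM : Fin 5 → Subgroup (W.divisionField 2 ≃ₐ[ℚ] W.divisionField 2) :=
    ![(ℚ⟮(⟨xT W two_ne_zero 0, xT_mem W 0⟩ : W.divisionField 2)⟯).fixingSubgroup,
      (ℚ⟮(⟨xT W two_ne_zero 1, xT_mem W 1⟩ : W.divisionField 2)⟯).fixingSubgroup,
      (ℚ⟮(⟨xT W two_ne_zero 2, xT_mem W 2⟩ : W.divisionField 2)⟯).fixingSubgroup,
      (ℚ⟮(⟨4 * delta W two_ne_zero, (delta_mem_and_sq W).1⟩ : W.divisionField 2)⟯).fixingSubgroup, ⊤] with hFAM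
  have hH : ∀ i, Function.Surjective (κ.toContinuousMonoidHom.comp (absGaloisRestrict ℚ ↥(fixedField (FAM i)))) :=
    fun i ↦ surjective_comp_absGaloisRestrict_of_tower κ ↥(fixedField (FAM i)) (W.divisionField 2) hL
  have tK : ∀ j : Fin 3, ∀ (hs : Function.Surjective (κ.toContinuousMonoidHom.comp
      (absGaloisRestrict ℚ ↥(fixedField (ℚ⟮(⟨xT W two_ne_zero j, xT_mem W j⟩ : W.divisionField 2)⟯).fixingSubgroup)))),
      ClassicalMuVanishes (κ.restrict _ hs) := by
    intro j hs
    obtain ⟨φ⟩ := nonempty_algEquiv_fixedField_cubic W j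
    have h' := surjective_cubic_restrict W ht κ j
    rw [classicalMuVanishes_restrict_iff_of_algEquiv κ φ hs h']
    exact hK j _ (isCyclotomic_restrict κ hκ _ h')
  have tC : ∀ (hs : Function.Surjective (κ.toContinuousMonoidHom.comp
      (absGaloisRestrict ℚ ↥(fixedField (ℚ⟮(⟨4 * delta W two_ne_zero, (delta_mem_and_sq W).1⟩ : W.divisionField 2)⟯).fixingSubgroup)))),
      ClassicalMuVanishes (κ.restrict _ hs) := by
    intro hs
    obtain ⟨φ⟩ := nonempty_algEquiv_fixedField_resolvent W
    have h' := surjective_resolvent_restrict W hΔ κ hκ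
    rw [classicalMuVanishes_restrict_iff_of_algEquiv κ φ hs h']
    exact hk _ (isCyclotomic_restrict κ hκ _ h')
  have tQ : ∀ (hs : Function.Surjective (κ.toContinuousMonoidHom.comp
      (absGaloisRestrict ℚ ↥(fixedField (⊤ : Subgroup (W.divisionField 2 ≃ₐ[ℚ] W.divisionField 2)))))),
      ClassicalMuVanishes (κ.restrict _ hs) := by
    intro hs
    obtain ⟨φ⟩ := nonempty_algEquiv_fixedField_top W
    have h' : Function.Surjective (κ.toContinuousMonoidHom.comp (absGaloisRestrict ℚ ℚ)) :=
      surjective_comp_absGaloisRestrict_of_not_dvd_finrank κ ℚ (by rw [Module.finrank_self]; decide)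
    rw [classicalMuVanishes_restrict_iff_of_algEquiv κ φ hs h']
    exact classicalMuVanishes_of_eventually_const _ (c := 0) (n₀ := 0) fun m _ => classNumberPExp_rat_eq_zero _ m
  have hμ : ∀ i, ClassicalMuVanishes (κ.restrict ↥(fixedField (FAM i)) (hH i)) := by
    intro i
    fin_cases i
    · exact tK 0 (hH 0)
    · exact tK 1 (hH 1)
    · exact tK 2 (hH 2)
    · exact tC (hH 3)
    · exact tQ (hH 4)
  have hT := classicalMuVanishes_restrict_of_normRelation' κ (W.divisionField 2) hL FAM
    (![fun x => if x = 1 then (1 : ℤ) else 0, fun x => if x = 1 then (1 : ℤ) else 0,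
        fun x => if x = 1 then (1 : ℤ) else 0, fun x => if x = 1 then (1 : ℤ) else 0,
        fun x => if x = 1 then (-1 : ℤ) else 0])
    (fun (_ : Fin 5) (y : W.divisionField 2 ≃ₐ[ℚ] W.divisionField 2) => if y = 1 then (1 : ℤ) else 0) (d := 3) (by decide)
    (normRelation_gal W ht hΔ) hH hμ
  exact (classicalMuVanishes_iff_of_isCyclotomic _ _ (isCyclotomic_restrict κ hκ _ hL) hκT).mp hT

end Summit.BirchSwinnertonDyer.BirchSwinnertonDyer.Theorems.AlignedTransportAtTwoSexticNormRelationDescentMu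

end
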